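import Summits.BirchSwinnertonDyer.BirchSwinnertonDyer.Theses.UniversalToricDescent

/-! # RK-7 v2 (Option B) — pen bsd-wall-pss3x g9, PLANNING ONLY (needs director GO per (356) r5; rides AFTER the 24254-R2 touch)

Trigger: LEAD utd-p1 g20 FINDING 13:10:03Z (20400 `TwinMuZeroAtThree` as typed = GOOD∧odd-d_K PRINT via p720953/leaf 20790
∧ B = Mult∧très-ramifié∧odd-d_K RESEARCH ∧ consumer-less corners) + utd-p1-w2 g7 13:25:51Z (G1 `BCSMuZeroInput → B → T`, G2 kernel_rat⁺
with T, G3 kernel⁵ with T, pre-GO as `--supports 20400` theorems).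

v1 (g8 memo, Option A) filed `TwinMuZeroAtThreeT` as an ITEM; but T can only close from the print leaf `BCSMuZeroInput` (20790) and the
research residue B, i.e. T would be ANOTHER open support on the cone that cannot close outright (20400's defect one level down) unless split.
v2 (Option B, this file): T is NOT an item. The kernels take `BCSMuZeroInput → TwinMuZeroAtThreeMultOdd →` in place of `TwinMuZeroAtThree →`,
the package carries B in place of 20400, and `closes` gains the print binder `h422 : BCSMuZeroInput` (20790 retriaged aside → support,
displayed by name like hF/hL). w2 g7's T-shaped G2/G3 compose with G1 in ONE line (adapters below), so no typed work is wasted.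
New items (4): `TwinMuZeroAtThreeMultOdd` (B; support r203′ → crux after vet), `ToricDefectEitherRoadMuBAtThree` (hP″),
`ToricKernelAtThreeApZeroOddDegreeMuBOfPrint` (hK″), `ToricKernelAtThreeApZeroOddRationalTwinMuBOfPrint` (hKr″). Leaves the cone: 20400 (→ aside),
24255 (→ drop), 22543/24256 stay CLOSED theorems off the binder list. Nothing is restated. -/

namespace Summit.BirchSwinnertonDyer.BirchSwinnertonDyer.Theses.UniversalToricDescent.RK7v2

/-- (not an item in v2; the T-shape w2 g7's G1/G2/G3 are typed against — g8 text 51f2aaf68cacd05b VERBATIM) -/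
def TwinMuZeroAtThreeT : Prop :=
  ∀ (W : WeierstrassCurve ℚ) [W.IsElliptic] [W.IsGloballyMinimal] (W' : WeierstrassCurve ℚ) [W'.IsElliptic] [W'.IsGloballyMinimal] (N N' : ℕ) [NeZero N] [NeZero N'] (K : Type) [Field K] [NumberField K] (Dt : Literature.NumberTheory.EllipticCurves.ModularForms.ModularParametrizationData W N) (Dt' : Literature.NumberTheory.EllipticCurves.ModularForms.ModularParametrizationData W' N'), Summit.BirchSwinnertonDyer.Rank1Residual.Additive.ClassO6 W 3 → W.HasSurjectiveModNGaloisRep 3 → W.analyticRank = 1 → W.conductorNorm ℤ = N → Summit.BirchSwinnertonDyer.Rank1Residual.O6.ModPCongruent W' W 3 → ¬ Literature.NumberTheory.EllipticCurves.Rank1Residual.Addv W' 3 → W'.conductorNorm ℤ = N' → Literature.NumberTheory.EllipticCurves.IsImaginaryQuadratic K → Literature.NumberTheory.EllipticCurves.SatisfiesHeegnerHypothesis N K → Literature.NumberTheory.EllipticCurves.SatisfiesHeegnerHypothesis N' K → Odd (NumberField.discr K) → (Literature.NumberTheory.EllipticCurves.Rank1Residual.GoodOrd W' 3 ∨ Literature.NumberTheory.EllipticCurves.Rank1Residual.Mult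 W' 3 ∧ ¬ 3 ∣ padicValInt 3 W'.minimalDiscriminantInt ∨ Literature.NumberTheory.EllipticCurves.Rank1Residual.GoodSS W' 3 ∧ W'.frobeniusTrace 3 = 0) → ∀ (κ : Literature.NumberTheory.EllipticCurves.ZpExtension K 3), κ.IsAnticyclotomic → ∀ (γ : Field.absoluteGaloisGroup K) [Fact (κ.IsTopGenerator γ)] (𝔭 : IsDedekindDomain.HeightOneSpectrum (NumberField.RingOfIntegers K)), ((3 : ℕ) : NumberField.RingOfIntegers K) ∈ 𝔭.asIdeal → 𝔭.asIdeal.ramificationIdx (NumberField.RingOfIntegers ℚ) = 1 → 𝔭.asIdeal.inertiaDeg (NumberField.RingOfIntegers ℚ) = 1 → ∀ (𝔭' : IsDedekindDomain.HeightOneSpectrum (NumberField.RingOfIntegers K)), ((3 : ℕ) : NumberField.RingOfIntegers K) ∈ 𝔭'.asIdeal → 𝔭' ≠ 𝔭 → ∀ (ι' : PadicAlgCl 3 ≃+* ℂ), Summit.BirchSwinnertonDyer.BirchSwinnertonDyer.Theorems.SchneiderFree.BranchInducesPrime 3 ι' 𝔭 → ∀ (ΩK : ℂ) (Ωp : ℂ_[3])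 (L' : Literature.NumberTheory.EllipticCurves.UnrSeries 3), ΩK ≠ 0 → Ωp ≠ 0 → Literature.NumberTheory.EllipticCurves.IsBDPLFunction ι' 𝔭 κ γ Dt'.f ΩK Ωp L' → ∃ i : ℕ, ‖((PowerSeries.coeff i L' : Literature.NumberTheory.EllipticCurves.unrIntegers 3) : ℂ_[3])‖ = 1

/-- NEW ITEM (B residue; g8 text VERBATIM): analytic μ = 0 of every BDP frame of a 3-congruent multiplicative TRÈS-RAMIFIÉ twin over an odd-d_K Heegner field. -/
def TwinMuZeroAtThreeMultOdd : Prop :=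
  ∀ (W : WeierstrassCurve ℚ) [W.IsElliptic] [W.IsGloballyMinimal] (W' : WeierstrassCurve ℚ) [W'.IsElliptic] [W'.IsGloballyMinimal] (N N' : ℕ) [NeZero N] [NeZero N'] (K : Type) [Field K] [NumberField K] (Dt : Literature.NumberTheory.EllipticCurves.ModularForms.ModularParametrizationData W N) (Dt' : Literature.NumberTheory.EllipticCurves.ModularForms.ModularParametrizationData W' N'), Summit.BirchSwinnertonDyer.Rank1Residual.Additive.ClassO6 W 3 → W.HasSurjectiveModNGaloisRep 3 → W.analyticRank = 1 → W.conductorNorm ℤ = N → Summit.BirchSwinnertonDyer.Rank1Residual.O6.ModPCongruent W' W 3 → ¬ Literature.NumberTheory.EllipticCurves.Rank1Residual.Addv W' 3 → W'.conductorNorm ℤ = N' → Literature.NumberTheory.EllipticCurves.IsImaginaryQuadratic K → Literature.NumberTheory.EllipticCurves.SatisfiesHeegnerHypothesis N K → Literature.NumberTheory.EllipticCurves.SatisfiesHeegnerHypothesis N' K → Odd (NumberField.discr K) → (Literature.NumberTheory.EllipticCurves.Rank1Residual.Mult W' 3 ∧ ¬ 3 ∣ padicValInt 3 W'.minimalDiscriminantInt)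 → ∀ (κ : Literature.NumberTheory.EllipticCurves.ZpExtension K 3), κ.IsAnticyclotomic → ∀ (γ : Field.absoluteGaloisGroup K) [Fact (κ.IsTopGenerator γ)] (𝔭 : IsDedekindDomain.HeightOneSpectrum (NumberField.RingOfIntegers K)), ((3 : ℕ) : NumberField.RingOfIntegers K) ∈ 𝔭.asIdeal → 𝔭.asIdeal.ramificationIdx (NumberField.RingOfIntegers ℚ) = 1 → 𝔭.asIdeal.inertiaDeg (NumberField.RingOfIntegers ℚ) = 1 → ∀ (𝔭' : IsDedekindDomain.HeightOneSpectrum (NumberField.RingOfIntegers K)), ((3 : ℕ) : NumberField.RingOfIntegers K) ∈ 𝔭'.asIdeal → 𝔭' ≠ 𝔭 → ∀ (ι' : PadicAlgCl 3 ≃+* ℂ), Summit.BirchSwinnertonDyer.BirchSwinnertonDyer.Theorems.SchneiderFree.BranchInducesPrime 3 ι' 𝔭 → ∀ (ΩK : ℂ) (Ωp : ℂ_[3]) (L' : Literature.NumberTheory.EllipticCurves.UnrSeries 3), ΩK ≠ 0 → Ωp ≠ 0 → Literature.NumberTheory.EllipticCurves.IsBDPLFunction ι' 𝔭 κ γ Dt'.f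 ΩK Ωp L' → ∃ i : ℕ, ‖((PowerSeries.coeff i L' : Literature.NumberTheory.EllipticCurves.unrIntegers 3) : ℂ_[3])‖ = 1

/-- NEW ITEM hP″ (package): either road, with B in place of 20400. -/
def ToricDefectEitherRoadMuBAtThree : Prop :=
  (DefectTransportModThreePT ∧ AdditiveSplitIMCInclusionAtThree ∧ TwinMuZeroAtThreeMultOdd) ∨ (SigmaCongruenceAtThree ∧ RationalSplitIMCInclusionAtThree ∧ TwinMuZeroAtThreeMultOdd ∧ TwinAlgMuZeroAtThree)

/-- NEW ITEM hK″ (kernel⁵ 22543's text with `TwinMuZeroAtThree →` ↦ `BCSMuZeroInput → TwinMuZeroAtThreeMultOdd →`). -/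
def ToricKernelAtThreeApZeroOddDegreeMuBOfPrint : Prop :=
  ToricPublishedInputs → DefectTransportModThreePT → AdditiveSplitIMCInclusionAtThree → BCSMuZeroInput → TwinMuZeroAtThreeMultOdd → TwinDegreeFrameAtThreeMultTresT ∧ TwinDegreeFrameAtThreeGoodSSApZeroT → GoodSSApZeroTwinSupplyAtThree → PeuRamifieMultTwinResupplyAtThree → WildSplitPrintedInputsAtThree → WildSplitFrameAtThreeOddOfPrint → ToricPrintedLeavesAtThree → WildRankZeroTwistAtThree → ∀ (W : WeierstrassCurve ℚ) [W.IsElliptic] [W.IsGloballyMinimal], Summit.BirchSwinnertonDyer.Rank1Residual.Additive.ClassO6 W 3 → W.analyticRank = 1 → W.HasSurjectiveModNGaloisRep 3 → (∃ (W' : WeierstrassCurve ℚ) (_ : W'.IsElliptic) (_ : W'.IsGloballyMinimal), Summit.BirchSwinnertonDyer.Rank1Residual.O6.ModPCongruent W' W 3 ∧ ¬ Literature.NumberTheory.EllipticCurves.Rank1Residual.Addv W' 3 ∧ W'.HasSurjectiveModNGaloisRep 3) → Literature.NumberTheory.EllipticCurves.BSDp W 3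

/-- NEW ITEM hKr″ (kernel_rat⁺ 24256's text with the same swap; `TwinAlgMuZeroAtThree` BY NAME, so R2-robust). -/
def ToricKernelAtThreeApZeroOddRationalTwinMuBOfPrint : Prop :=
  ToricPublishedInputs → SigmaCongruenceAtThree → RationalSplitIMCInclusionAtThree → BCSMuZeroInput → TwinMuZeroAtThreeMultOdd → TwinAlgMuZeroAtThree → TwinDegreeFrameAtThreeMultTresT ∧ TwinDegreeFrameAtThreeGoodSSApZeroT → GoodSSApZeroTwinSupplyAtThree → PeuRamifieMultTwinResupplyAtThree → WildSplitPrintedInputsAtThree → WildSplitFrameAtThreeOddOfPrint → ToricPrintedLeavesAtThree → WildRankZeroTwistAtThree → ∀ (W : WeierstrassCurve ℚ) [W.IsElliptic] [W.IsGloballyMinimal], Summit.BirchSwinnertonDyer.Rank1Residual.Additive.ClassO6 W 3 → W.analyticRank = 1 → W.HasSurjectiveModNGaloisRep 3 → (∃ (W' : WeierstrassCurve ℚ) (_ : W'.IsElliptic) (_ : W'.IsGloballyMinimal), Summit.BirchSwinnertonDyer.Rank1Residual.O6.ModPCongruent W' W 3 ∧ ¬ Literature.NumberTheory.EllipticCurves.Rank1Residual.Addv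 W' 3 ∧ W'.HasSurjectiveModNGaloisRep 3) → Literature.NumberTheory.EllipticCurves.BSDp W 3

/-! ## certs -/

theorem T_of_live (h : TwinMuZeroAtThree) : TwinMuZeroAtThreeT := by
  intro W _ _ W' _ _ N N' _ _ K _ _ Dt Dt' hO6 hsurj hrk hN hcong hAddv hN' hK hH hH' _hodd _hbucket
  exact h W W' N N' K Dt Dt' hO6 hsurj hrk hN hcong hAddv hN' hK hH hH'

theorem multOdd_of_T (h : TwinMuZeroAtThreeT) : TwinMuZeroAtThreeMultOdd := by
  intro W _ _ W' _ _ N N' _ _ K _ _ Dt Dt' hO6 hsurj hrk hN hcong hAddv hN' hK hH hH' hodd hB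
  exact h W W' N N' K Dt Dt' hO6 hsurj hrk hN hcong hAddv hN' hK hH hH' hodd (Or.inr (Or.inl hB))

theorem multOdd_of_live (h : TwinMuZeroAtThree) : TwinMuZeroAtThreeMultOdd := multOdd_of_T (T_of_live h)

/-- the live package 24255 implies hP″ (so hP″ closes from whatever closes 24255's pieces). -/
theorem pkgB_of_pkg (h : ToricDefectEitherRoadMuAtThree) : ToricDefectEitherRoadMuBAtThree :=
  h.elim (fun h => Or.inl ⟨h.1, h.2.1, multOdd_of_live h.2.2⟩) (fun h => Or.inr ⟨h.1, h.2.1, multOdd_of_live h.2.2.1, h.2.2.2⟩)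

/-- ADAPTER hK″ ⟸ G1 + a T-shaped kernel⁵ (w2 g7's G3): one line. -/
theorem kernel5B_of_G1_of_kernel5T (G1 : BCSMuZeroInput → TwinMuZeroAtThreeMultOdd → TwinMuZeroAtThreeT)
    (kT : ToricPublishedInputs → DefectTransportModThreePT → AdditiveSplitIMCInclusionAtThree → TwinMuZeroAtThreeT → TwinDegreeFrameAtThreeMultTresT ∧ TwinDegreeFrameAtThreeGoodSSApZeroT → GoodSSApZeroTwinSupplyAtThree → PeuRamifieMultTwinResupplyAtThree → WildSplitPrintedInputsAtThree → WildSplitFrameAtThreeOddOfPrint → ToricPrintedLeavesAtThree → WildRankZeroTwistAtThree → ∀ (W : WeierstrassCurve ℚ) [W.IsElliptic] [W.IsGloballyMinimal], Summit.BirchSwinnertonDyer.Rank1Residual.Additive.ClassO6 W 3 → W.analyticRank = 1 → W.HasSurjectiveModNGaloisRep 3 → (∃ (W' : WeierstrassCurve ℚ) (_ : W'.IsElliptic) (_ : W'.IsGloballyMinimal), Summit.BirchSwinnertonDyer.Rank1Residual.O6.ModPCongruent W' W 3 ∧ ¬ Literature.NumberTheory.EllipticCurves.Rank1Residual.Addv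 W' 3 ∧ W'.HasSurjectiveModNGaloisRep 3) → Literature.NumberTheory.EllipticCurves.BSDp W 3) : ToricKernelAtThreeApZeroOddDegreeMuBOfPrint :=
  by
  intro hF hD hA h422 hB
  exact kT hF hD hA (G1 h422 hB)

/-- ADAPTER hKr″ ⟸ G1 + a T-shaped kernel_rat⁺ (w2 g7's G2 `kernelRat_of_r2Text_of_tText`, by-name form): one line. -/
theorem kernelRatB_of_G1_of_kernelRatT (G1 : BCSMuZeroInput → TwinMuZeroAtThreeMultOdd → TwinMuZeroAtThreeT)
    (kT : ToricPublishedInputs → SigmaCongruenceAtThree → RationalSplitIMCInclusionAtThree → TwinMuZeroAtThreeT → TwinAlgMuZeroAtThree → TwinDegreeFrameAtThreeMultTresT ∧ TwinDegreeFrameAtThreeGoodSSApZeroT → GoodSSApZeroTwinSupplyAtThree → PeuRamifieMultTwinResupplyAtThree → WildSplitPrintedInputsAtThree → WildSplitFrameAtThreeOddOfPrint → ToricPrintedLeavesAtThree → WildRankZeroTwistAtThree → ∀ (W : WeierstrassCurve ℚ) [W.IsElliptic] [W.IsGloballyMinimal], Summit.BirchSwinnertonDyer.Rank1Residual.Additive.ClassO6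 W 3 → W.analyticRank = 1 → W.HasSurjectiveModNGaloisRep 3 → (∃ (W' : WeierstrassCurve ℚ) (_ : W'.IsElliptic) (_ : W'.IsGloballyMinimal), Summit.BirchSwinnertonDyer.Rank1Residual.O6.ModPCongruent W' W 3 ∧ ¬ Literature.NumberTheory.EllipticCurves.Rank1Residual.Addv W' 3 ∧ W'.HasSurjectiveModNGaloisRep 3) → Literature.NumberTheory.EllipticCurves.BSDp W 3) : ToricKernelAtThreeApZeroOddRationalTwinMuBOfPrint :=
  by
  intro hF hA hR h422 hB
  exact kT hF hA hR (G1 h422 hB)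

/-- closes v5 (13 binders): the rung leaf from the v2 package + kernels, term = glue_v4's with h422/B threaded. -/
theorem closes_v5 (hF : ToricPublishedInputs) (h422 : BCSMuZeroInput) (hP : ToricDefectEitherRoadMuBAtThree) (hB : TwinDegreeFrameAtThreeMultTresT) (hC : TwinDegreeFrameAtThreeGoodSSApZeroT) (hsupply : GoodSSApZeroTwinSupplyAtThree) (hR : PeuRamifieMultTwinResupplyAtThree) (hW : WildSplitPrintedInputsAtThree) (hS : WildSplitFrameAtThreeOddOfPrint) (hL : ToricPrintedLeavesAtThree) (hZ : WildRankZeroTwistAtThree) (hK : ToricKernelAtThreeApZeroOddDegreeMuBOfPrint) (hKr : ToricKernelAtThreeApZeroOddRationalTwinMuBOfPrint) : Summit.BirchSwinnertonDyer.WAllExclAddWildRankOneSurjTwin :=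
  hP.elim (fun h ↦ Summit.BirchSwinnertonDyer.wAllExclAddWildRankOneSurjTwin_of_forall (hK hF h.1 h.2.1 h422 h.2.2 ⟨hB, hC⟩ hsupply hR hW hS hL hZ)) (fun h ↦ Summit.BirchSwinnertonDyer.wAllExclAddWildRankOneSurjTwin_of_forall (hKr hF h.1 h.2.1 h422 h.2.2.1 h.2.2.2 ⟨hB, hC⟩ hsupply hR hW hS hL hZ))

/-- sanity: the v4 closes cone implies the v5 one item-wise (old package ⇒ new package above; old kernels are NOT implied — they are re-proved by LEAD/width from G1–G3). -/
example (hP : ToricDefectEitherRoadMuAtThree) : ToricDefectEitherRoadMuBAtThree := pkgB_of_pkg hP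

end Summit.BirchSwinnertonDyer.BirchSwinnertonDyer.Theses.UniversalToricDescent.RK7v2
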